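import Summits.QuantumFields.YangMills.Theorems.BalabanUVNodesN11Sect3SupplySplice
import Literature.MathematicalPhysics.QuantumFieldTheory.Balaban1983to89.Node00.Record13SepCoPHChi
import Literature.MathematicalPhysics.QuantumFieldTheory.Balaban1983to89.Node00.Record13ResidualsRChi
import Summits.QuantumFields.YangMills.Theorems.BalabanUVNodesN11HistoryPinnedResidualDefsChi
import Summits.QuantumFields.YangMills.Theorems.BalabanUVNodesN11RePinnedParamDefsChi
import Summits.QuantumFields.YangMills.Theorems.BalabanUVNodesN11NoExpansionAtRecord13CoPChi
import Summits.QuantumFields.YangMills.Theorems.BalabanUVNodesN11NoExpansionDiagonalCoPHChi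
import Summits.QuantumFields.YangMills.Theorems.BalabanUVNodesN11BackgroundScaleLocalChi
import Summits.QuantumFields.YangMills.Theorems.BalabanUVNodesN11Sect3SupplyPresentParentsChi
import Summits.QuantumFields.YangMills.Theorems.BalabanUVNodesN11NoExpansionOldFactorsChi
import Summits.QuantumFields.YangMills.Theorems.BalabanUVNodesN11NoExpansionGeneralStepCoPHOldBranchChi
import Summits.QuantumFields.YangMills.Theorems.BalabanUVNodesN11NoExpansionGeneralStepLawsCoPHChi
import Summits.QuantumFields.YangMills.Theorems.BalabanUVNodesN11NoExpansionGeneralStepGraphChi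
import Summits.QuantumFields.YangMills.Theorems.BalabanUVNodesN11DiagonalOldBranchMeasurableChi
import Summits.QuantumFields.YangMills.Theorems.BalabanUVNodesN11OldBranchPairChi
import Summits.QuantumFields.YangMills.Theorems.BalabanUVNodesN11TruncationDominationChi
import Literature.MathematicalPhysics.QuantumFieldTheory.Balaban1983to89.B16RLeafRecord13LiveChi
import Summits.QuantumFields.YangMills.Theorems.BalabanUVNodesN11Sect3SupplySpliceOwnBoundary

/-!
# χ-GENERIC RE-ISSUE (WORK ORDER RC-1) — MERGED MODULE `BalabanUVNodesN11Sect3SupplySplicePairChi` holding the sibling twins of `BalabanUVNodesN11Sect3SupplySplice`, `BalabanUVNodesN11Sect3SupplySpliceOwnBoundary`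

(dag-n11-d g44, N11-σ chain; one file = fewer gate∕farm round-trips; each member keeps its own sibling namespace `…<Member>Chi` and its own header below.)
-/

/-!
# χ-GENERIC RE-ISSUE (WORK ORDER RC-1 «RE-CENTRE THE RECORD», director-ym №462 (B) ∕ №467 (D)) of `BalabanUVNodesN11Sect3SupplySplice`

Cell `pub-ymgap` (HUMAN RULING D-0062, Track A), seat `pub-ymgap-dag-n11-d` (N11 [B14] s2; N11-σ campaign, `N11-G44-RC1-REACH-CENSUS.md`).  The CENTRE-TYPED
declarations of `BalabanUVNodesN11Sect3SupplySplice` (those whose statement reads the (2.9) cut-off centre through `gOfRecord₁₃ ∕ EOfRecord₁₃ ∕ Provisos₁₃… ∕ T∕SLaw₁₃… ∕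
UbgOfRecord₁₃… ∕ WtOfRecord₁₃… ∕ datum∕tower∕coreOfRecord₁₃…`) RE-ISSUED VERBATIM in the β-slot `χ : ChiSlot F N` over [Ax-3b]∕[Ax-3c]∕[Ax-3d]'s χ-generic carriers
(`Node00/Record13Chi` ∕ `Record13CoPHChi` ∕ `Record13SepCoPHChi`): σ = (binder `(χ : ChiSlot F N)` after `θ`; Node00 defs `X ↦ XChi … χ`; Node00 rows `Y ↦ Y_chi`;
this lane's sibling modules `…Chi` for Summits-side dependencies); SAME short names in the sibling namespace `…BalabanUVNodesN11Sect3SupplySpliceChi` (consumers switch by namespace);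
the 7 centre-FREE declarations of the original are NOT copied — they are reused BY NAME (`open … (…)` below).  At `χ := chiβOfRecord₁₃ θ` every statement here is
DEFINITIONALLY the landed one ([Ax-3b]'s `rfl` receipts); at `χ := chiβOfRecord₁₃Ax θ` it is what the Ax-record's N11 machine reads.  Nothing of record edited (body-freeze №460 (2)).

HONEST FRAMING.  Count-neutral kernel re-elaboration of landed N11 bookkeeping∕estimates in a parameter; every HYPOTHESIS of the original stays a hypothesis; nothing of
Bałaban asserted beyond what the original file proves; N11 NOT discharged; K-items untouched; counts unmoved.  One finite `𝕋⁴_{L^K}` programme at fixed `ε = L^{−K}` —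
NOT ℝ⁴, NOT OS, NOT a mass gap, NOT Clay.  No `sorry`∕`instance`∕`notation`.  Sources: as the original module, plus [I] = [Balaban1987RG1] (2.9) p.266 (the cut-off's centre).
-/

noncomputable section

open MeasureTheory
open scoped BigOperators Matrix.Norms.L2Operator

namespace Summit.QuantumFields.YangMills.Theorems.BalabanUVNodesN11Sect3SupplySpliceChi

open Summit.QuantumFields.YangMills.Theorems.BalabanUVNodesN11Sect3SupplySplice (lawsT_child_graftAbove_of_rows o1_one_of_lawsRT sect3SupplyAt_of_spliceSupply thmP245Laws_of_tStep_of_spliceSupply sLaw₁₃CoPH_all_of_tStep_of_spliceSupply_of_liveSel sLaw₁₃CoPH_all_theta13LiveOfRecordH_of_tStep_of_spliceSupply sLaw₁₃CoPH_one_rePinH_doorCured_theta13LiveOfRecord_of_spliceSupply_zero)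
open Literature.MathematicalPhysics.QuantumFieldTheory.Balaban1983to89 T4Continuum Node00 Node00.Tk DagBinding
open Step B14.Eq227LocalizedTerms
open Literature.MathematicalPhysics.QuantumFieldTheory.Balaban1983to89.B16RLeafRecord13AtLive (B0_nonneg_theta13LiveOfFamily E0_nonneg_theta13LiveOfFamily)
open BalabanUVNodesN11Sect3SupplyDefs (Sect3SupplyAt NoExpansionTStepAt)
open BalabanUVNodesN11Sect3SupplySpliceDefs
open BalabanUVNodesN11Sect3SupplySpliceFrame
open BalabanUVNodesN11Sect3SupplyPresentParentsChi (slotsTOfRecord₁₃H_succ_eq_zero_of_init_eq_zero)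
open BalabanUVNodesN11NoExpansionStepReductionRePinnedUnivECoPH (newEClauses_of_lawsT_of_eqE)
open BalabanUVNodesN11ThmP245OfSect3SupplyCoPH (sLaw₁₃CoPH_all_of_tStep_of_supply_of_liveSel sLaw₁₃CoPH_all_theta13LiveOfRecordH_of_tStep_of_supply
  sLaw₁₃CoPH_one_rePinH_doorCured_theta13LiveOfRecord_of_sect3Supply_zero thmP245Laws_of_tStep_of_supply)
open BalabanUVNodesN11RePinnedParamDefsChi (rePinH)

variable {F : T4Family} {N : ℕ} [NeZero N]
variable (θ : Stage13HParams F N) (χ : ChiSlot F N) (p : B12.RunParams)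

/-! ## §0. The laws of the two expansion-child witnesses on the child's tower of record -/

section ChildLaws

/-- **THE 𝐓-IMAGE LAWS AT AN EXPANSION CHILD OF AN ABSENT PARENT** for the witness `graftAbove k (dropBFrom k tpar) (zeroRB u)` (old `𝐄 ∕ 𝐑` and the old `𝐁^{(j)}`, `j < k`, of
`tpar`; `𝐁^{(k)} := 0`; the universal new `𝐄^{(k+1)}` of `u`; no new `𝐑 ∕ 𝐁`): from the parent's inductive assumptions for `tpar` and the FOUR level-`(k+1)` 𝐄-CLAUSES of the
witness on the child's tower (transferred from elsewhere by the caller) — the zeroed terms obey their laws by `0 ≤ B₀`, `0 ≤ g_{k+1}` and the RG equation of record.  NOTHING is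
owed by a supplier here. [cite: Balaban1988Convergent, §2 p.262, (3.25) p.270, (2.27)–(2.31) pp.259–260, (2.40)–(2.42) p.261; Balaban1987RG1, (0.20) p.256] -/
theorem lawsT_child_absent_of_newEClauses (hB₀ : 0 ≤ θ.s2.lf.B₀) {k : ℕ} (s : SeqOfRecord F θ.ν θ.τ9.M (gOfRecord₁₃Chi F N θ.toStage13Params χ p) p.K (k + 1))
    {tpar u : Sect2.TermValues (F.P p.K) (MatA N) (FluctV N) θ.τ9.M}
    (hlaw : Sect2.LawsRT (sect2TowerOfRecord F N (FluctV N) p.K (settingOfRecord₁₃Chi F N θ.toStage13Params χ p) (θ.rzAtChi χ p s.init) s.init tpar)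
      (settingOfRecord₁₃Chi F N θ.toStage13Params χ p).lf k)
    (hEcl :
      (∀ X z g φ ψ, (sect2TowerOfRecord F N (FluctV N) p.K (settingOfRecord₁₃Chi F N θ.toStage13Params χ p) (θ.rzAtChi χ p s) s (graftAbove k (dropBFrom k tpar) (zeroRB u))).agreeOn (k + 1) X φ ψ →
        (graftAbove k (dropBFrom k tpar) (zeroRB u)).E (k + 1) X z g φ = (graftAbove k (dropBFrom k tpar) (zeroRB u)).E (k + 1) X z g ψ) ∧
      (∀ X z g v φ, (graftAbove k (dropBFrom k tpar) (zeroRB u)).E (k + 1) X z g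
          ((sect2TowerOfRecord F N (FluctV N) p.K (settingOfRecord₁₃Chi F N θ.toStage13Params χ p) (θ.rzAtChi χ p s) s (graftAbove k (dropBFrom k tpar) (zeroRB u))).act v φ) =
        (graftAbove k (dropBFrom k tpar) (zeroRB u)).E (k + 1) X z g φ) ∧
      (∀ X z g φ, 0 ≤ g → g ≤ (settingOfRecord₁₃Chi F N θ.toStage13Params χ p).lf.γ →
        φ ∈ (sect2TowerOfRecord F N (FluctV N) p.K (settingOfRecord₁₃Chi F N θ.toStage13Params χ p) (θ.rzAtChi χ p s) s (graftAbove k (dropBFrom k tpar) (zeroRB u))).space (k + 1) X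
            ((settingOfRecord₁₃Chi F N θ.toStage13Params χ p).lf.alpha0 ((settingOfRecord₁₃Chi F N θ.toStage13Params χ p).flow.g (k + 1)))
            ((settingOfRecord₁₃Chi F N θ.toStage13Params χ p).lf.alpha1 ((settingOfRecord₁₃Chi F N θ.toStage13Params χ p).flow.g (k + 1))) →
          ‖(graftAbove k (dropBFrom k tpar) (zeroRB u)).E (k + 1) X z g φ‖ ≤
            (settingOfRecord₁₃Chi F N θ.toStage13Params χ p).lf.E₀ *
              Real.exp (-((1 + 4 * (settingOfRecord₁₃Chi F N θ.toStage13Params χ p).βc) * (settingOfRecord₁₃Chi F N θ.toStage13Params χ p).lf.κ) * (Sect2.domSys (F.P p.K) θ.τ9.M (k + 1)).dj X)) ∧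
      (∀ X z g, 0 ≤ g → g ≤ (settingOfRecord₁₃Chi F N θ.toStage13Params χ p).lf.γ →
        AnalyticOnNhd ℂ ((graftAbove k (dropBFrom k tpar) (zeroRB u)).E (k + 1) X z g)
          ((sect2TowerOfRecord F N (FluctV N) p.K (settingOfRecord₁₃Chi F N θ.toStage13Params χ p) (θ.rzAtChi χ p s) s (graftAbove k (dropBFrom k tpar) (zeroRB u))).space (k + 1) X
            ((settingOfRecord₁₃Chi F N θ.toStage13Params χ p).lf.alpha0 ((settingOfRecord₁₃Chi F N θ.toStage13Params χ p).flow.g (k + 1)))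
            ((settingOfRecord₁₃Chi F N θ.toStage13Params χ p).lf.alpha1 ((settingOfRecord₁₃Chi F N θ.toStage13Params χ p).flow.g (k + 1)))))) :
    Sect2.LawsT (sect2TowerOfRecord F N (FluctV N) p.K (settingOfRecord₁₃Chi F N θ.toStage13Params χ p) (θ.rzAtChi χ p s) s (graftAbove k (dropBFrom k tpar) (zeroRB u)))
      (settingOfRecord₁₃Chi F N θ.toStage13Params χ p).lf (settingOfRecord₁₃Chi F N θ.toStage13Params χ p).βc k := by
  obtain ⟨hlocE, hinvE, hbdE, hanE⟩ := hEcl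
  have hlt := Nat.lt_succ_self k
  have hR' : ∀ X φ, (graftAbove k (dropBFrom k tpar) (zeroRB u)).R (k + 1) X φ = 0 := fun X φ => by
    rw [graftAbove_R_of_lt _ _ hlt]; rfl
  have hB' : ∀ X φ a, (graftAbove k (dropBFrom k tpar) (zeroRB u)).B (k + 1) X φ a = 0 := fun X φ a => by
    rw [graftAbove_B_of_lt _ _ hlt]; rfl
  have hBk : ∀ X φ a, (graftAbove k (dropBFrom k tpar) (zeroRB u)).B k X φ a = 0 := fun X φ a => by
    rw [graftAbove_B_of_le _ _ le_rfl, dropBFrom_B_of_le _ le_rfl]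
  refine lawsT_towerOfTerms_crossFrame (settingOfRecord₁₃Chi F N θ.toStage13Params χ p) (Rz := θ.rzAtChi χ p s.init) (Rz' := θ.rzAtChi χ p s) rfl rfl
    (Ω := s.init.Ω) (Ω' := s.Ω) (fun i hi => (seq_init_Ω_of_le s hi).symm) (t := tpar) (t' := graftAbove k (dropBFrom k tpar) (zeroRB u))
    (fun j hj X z g φ => graftAbove_E_of_le (dropBFrom k tpar) (zeroRB u) hj X z g φ) (fun j hj X φ => graftAbove_R_of_le (dropBFrom k tpar) (zeroRB u) hj X φ)
    (fun j hj X φ a => ?_) hlaw (fun _ X φ a _ => ?_) (fun _ X a => ?_)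
    (lfNewTerms_of_newE_of_noR_of_noB _ _ _ (settingOfRecord₁₃_satisfiesRG_chi F N θ.toStage13Params χ p (k + 1) k hlt) hR' hB' hlocE hinvE hbdE hB₀
      (B16RLeafRecord13LiveChi.gOfRecord₁₃_succ_nonneg F N θ.toStage13Params χ p k))
    hanE (fun X => analyticR_of_noR hR' X _) (fun X a => analyticB_of_noB hB' X a _)
  · rw [graftAbove_B_of_le _ _ hj.le X φ a, dropBFrom_B_of_lt _ hj]
  · rw [hBk, norm_zero]; exact mul_nonneg hB₀ (Real.exp_nonneg _)
  · exact analyticB_of_noB (j := k) hBk X a _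

end ChildLaws

/-! ## §1. The minimal supply gives the supply -/

/-! ## §2. Theorem 1 and the (S1ᵀ) slot re-keyed on the minimal supply -/

end Summit.QuantumFields.YangMills.Theorems.BalabanUVNodesN11Sect3SupplySpliceChi

end



/-!
# χ-GENERIC RE-ISSUE (WORK ORDER RC-1 «RE-CENTRE THE RECORD», director-ym №462 (B) ∕ №467 (D)) of `BalabanUVNodesN11Sect3SupplySpliceOwnBoundary`

Cell `pub-ymgap` (HUMAN RULING D-0062, Track A), seat `pub-ymgap-dag-n11-d` (N11 [B14] s2; N11-σ campaign, `N11-G44-RC1-REACH-CENSUS.md`).  The CENTRE-TYPED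
declarations of `BalabanUVNodesN11Sect3SupplySpliceOwnBoundary` (those whose statement reads the (2.9) cut-off centre through `gOfRecord₁₃ ∕ EOfRecord₁₃ ∕ Provisos₁₃… ∕ T∕SLaw₁₃… ∕
UbgOfRecord₁₃… ∕ WtOfRecord₁₃… ∕ datum∕tower∕coreOfRecord₁₃…`) RE-ISSUED VERBATIM in the β-slot `χ : ChiSlot F N` over [Ax-3b]∕[Ax-3c]∕[Ax-3d]'s χ-generic carriers
(`Node00/Record13Chi` ∕ `Record13CoPHChi` ∕ `Record13SepCoPHChi`): σ = (binder `(χ : ChiSlot F N)` after `θ`; Node00 defs `X ↦ XChi … χ`; Node00 rows `Y ↦ Y_chi`;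
this lane's sibling modules `…Chi` for Summits-side dependencies); SAME short names in the sibling namespace `…BalabanUVNodesN11Sect3SupplySpliceOwnBoundaryChi` (consumers switch by namespace);
the 15 centre-FREE declarations of the original are NOT copied — they are reused BY NAME (`open … (…)` below).  At `χ := chiβOfRecord₁₃ θ` every statement here is
DEFINITIONALLY the landed one ([Ax-3b]'s `rfl` receipts); at `χ := chiβOfRecord₁₃Ax θ` it is what the Ax-record's N11 machine reads.  Nothing of record edited (body-freeze №460 (2)).

HONEST FRAMING.  Count-neutral kernel re-elaboration of landed N11 bookkeeping∕estimates in a parameter; every HYPOTHESIS of the original stays a hypothesis; nothing of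
Bałaban asserted beyond what the original file proves; N11 NOT discharged; K-items untouched; counts unmoved.  One finite `𝕋⁴_{L^K}` programme at fixed `ε = L^{−K}` —
NOT ℝ⁴, NOT OS, NOT a mass gap, NOT Clay.  No `sorry`∕`instance`∕`notation`.  Sources: as the original module, plus [I] = [Balaban1987RG1] (2.9) p.266 (the cut-off's centre).
-/

noncomputable section

open MeasureTheory
open scoped BigOperators Matrix.Norms.L2Operator

namespace Summit.QuantumFields.YangMills.Theorems.BalabanUVNodesN11Sect3SupplySpliceOwnBoundaryChi

open Summit.QuantumFields.YangMills.Theorems.BalabanUVNodesN11Sect3SupplySpliceOwnBoundary (graftAboveB graftAboveB_E graftAboveB_E_of_le graftAboveB_R_of_le graftAboveB_B_of_lt graftAboveB_B_of_le graftAboveB_E_of_lt graftAboveB_R_of_lt graftAboveB_E_succ graftAboveB_R_succ graftAboveB_B_fun_of_le lfNewTerms_graftAboveB sect3SupplyAt_of_ownBSupply_of_guard sect3SupplyAt_of_ownBSupply_at_present_children sect3SupplyAt_of_ownBSupply_at_labels)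
open Literature.MathematicalPhysics.QuantumFieldTheory.Balaban1983to89 T4Continuum Node00 Node00.Tk DagBinding
open Step B14.Eq227LocalizedTerms
open Literature.MathematicalPhysics.QuantumFieldTheory.Balaban1983to89.B14SeparationOfRecord (exists_label_of_slotsTOfRecord_succ_ne_zero)
open BalabanUVNodesN11Sect3SupplyDefs (Sect3SupplyAt)
open BalabanUVNodesN11Sect3SupplySpliceDefs
open BalabanUVNodesN11Sect3SupplySpliceFrame
open BalabanUVNodesN11Sect3SupplySpliceChi (lawsT_child_absent_of_newEClauses)
open BalabanUVNodesN11NoExpansionStepReductionRePinnedUnivECoPH (newEClauses_of_lawsT_of_eqE)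

/-! ## §1  The graft with the level-`k` boundary term from the new source -/

variable {F : T4Family} {N : ℕ} [NeZero N]
variable (θ : Stage13HParams F N) (χ : ChiSlot F N) (p : B12.RunParams)

/-! ## §2  The child's laws for the graft with the re-issued boundary term -/

section ChildLaws

/-- **THE 𝐓-IMAGE LAWS AT AN EXPANSION CHILD for `graftAboveB k tpar u`**: from the parent's inductive assumptions for `tpar` (`Sect2.LawsRT` at `init s′`), (O1′) the bound and
analyticity of the SUPPLIER's `u.B k` on the child's `Ũ^c_k(X)` (void at `k = 0`), and (O2) r11's new-term obligations + analyticity at `k+1` for `u` — by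
`…SpliceFrame.lawsT_towerOfTerms_crossFrame` with `𝐁`-agreement below `k` only. [cite: Balaban1988Convergent, §2 p.262, §3 p.279, (2.27)–(2.31) pp.259–260, (2.38)–(2.42) p.261] -/
theorem lawsT_child_graftAboveB_of_rows {k : ℕ} (s : SeqOfRecord F θ.ν θ.τ9.M (gOfRecord₁₃Chi F N θ.toStage13Params χ p) p.K (k + 1)) {tpar u : Sect2.TermValues (F.P p.K) (MatA N) (FluctV N) θ.τ9.M}
    (hlaw : Sect2.LawsRT (sect2TowerOfRecord F N (FluctV N) p.K (settingOfRecord₁₃Chi F N θ.toStage13Params χ p) (θ.rzAtChi χ p s.init) s.init tpar) (settingOfRecord₁₃Chi F N θ.toStage13Params χ p).lf k)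
    (hO1 : 1 ≤ k →
      (∀ (X : (Sect2.domSys (F.P p.K) θ.τ9.M k).Dom) (φ : Sect2.CPair (F.P p.K) (MatA N)) (a : SFluct (F.P p.K) (FluctV N)),
        φ ∈ (sect2TowerOfRecord F N (FluctV N) p.K (settingOfRecord₁₃Chi F N θ.toStage13Params χ p) (θ.rzAtChi χ p s) s u).spaceB k X →
          ‖u.B k X φ a‖ ≤ (settingOfRecord₁₃Chi F N θ.toStage13Params χ p).lf.B₀ * Real.exp (-(settingOfRecord₁₃Chi F N θ.toStage13Params χ p).lf.κ * (Sect2.domSys (F.P p.K) θ.τ9.M k).dj X)) ∧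
      (∀ (X : (Sect2.domSys (F.P p.K) θ.τ9.M k).Dom) (a : SFluct (F.P p.K) (FluctV N)),
        AnalyticOnNhd ℂ (fun φ => u.B k X φ a) ((sect2TowerOfRecord F N (FluctV N) p.K (settingOfRecord₁₃Chi F N θ.toStage13Params χ p) (θ.rzAtChi χ p s) s u).spaceB k X)))
    (hO2 : Step.LFNewTerms (sect2TowerOfRecord F N (FluctV N) p.K (settingOfRecord₁₃Chi F N θ.toStage13Params χ p) (θ.rzAtChi χ p s) s u) (settingOfRecord₁₃Chi F N θ.toStage13Params χ p).lf (settingOfRecord₁₃Chi F N θ.toStage13Params χ p).βc k)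
    (hanE : ∀ (X : (Sect2.domSys (F.P p.K) θ.τ9.M (k + 1)).Dom) (z : Site (F.P p.K) (k + 1)) (g : ℝ), 0 ≤ g → g ≤ (settingOfRecord₁₃Chi F N θ.toStage13Params χ p).lf.γ →
      AnalyticOnNhd ℂ (u.E (k + 1) X z g)
        ((sect2TowerOfRecord F N (FluctV N) p.K (settingOfRecord₁₃Chi F N θ.toStage13Params χ p) (θ.rzAtChi χ p s) s u).space (k + 1) X
          ((settingOfRecord₁₃Chi F N θ.toStage13Params χ p).lf.alpha0 ((settingOfRecord₁₃Chi F N θ.toStage13Params χ p).flow.g (k + 1))) ((settingOfRecord₁₃Chi F N θ.toStage13Params χ p).lf.alpha1 ((settingOfRecord₁₃Chi F N θ.toStage13Params χ p).flow.g (k + 1)))))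
    (hanR : ∀ X : (Sect2.domSys (F.P p.K) θ.τ9.M (k + 1)).Dom,
      AnalyticOnNhd ℂ (u.R (k + 1) X)
        ((sect2TowerOfRecord F N (FluctV N) p.K (settingOfRecord₁₃Chi F N θ.toStage13Params χ p) (θ.rzAtChi χ p s) s u).space (k + 1) X
          ((settingOfRecord₁₃Chi F N θ.toStage13Params χ p).lf.alpha0 ((settingOfRecord₁₃Chi F N θ.toStage13Params χ p).flow.g (k + 1))) ((settingOfRecord₁₃Chi F N θ.toStage13Params χ p).lf.alpha1 ((settingOfRecord₁₃Chi F N θ.toStage13Params χ p).flow.g (k + 1)))))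
    (hanB : ∀ (X : (Sect2.domSys (F.P p.K) θ.τ9.M (k + 1)).Dom) (a : SFluct (F.P p.K) (FluctV N)),
      AnalyticOnNhd ℂ (fun φ => u.B (k + 1) X φ a) ((sect2TowerOfRecord F N (FluctV N) p.K (settingOfRecord₁₃Chi F N θ.toStage13Params χ p) (θ.rzAtChi χ p s) s u).spaceB (k + 1) X)) :
    Sect2.LawsT (sect2TowerOfRecord F N (FluctV N) p.K (settingOfRecord₁₃Chi F N θ.toStage13Params χ p) (θ.rzAtChi χ p s) s (graftAboveB k tpar u)) (settingOfRecord₁₃Chi F N θ.toStage13Params χ p).lf (settingOfRecord₁₃Chi F N θ.toStage13Params χ p).βc k := by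
  refine lawsT_towerOfTerms_crossFrame (settingOfRecord₁₃Chi F N θ.toStage13Params χ p) (Rz := θ.rzAtChi χ p s.init) (Rz' := θ.rzAtChi χ p s) rfl rfl
    (Ω := s.init.Ω) (Ω' := s.Ω) (fun i hi => (seq_init_Ω_of_le s hi).symm) (t := tpar) (t' := graftAboveB k tpar u)
    (fun j hj X z g φ => graftAboveB_E_of_le tpar u hj X z g φ) (fun j hj X φ => graftAboveB_R_of_le tpar u hj X φ)
    (fun j hj X φ a => graftAboveB_B_of_lt tpar u hj X φ a) hlaw (fun h1 X φ a hφ => ?_) (fun h1 X a => ?_)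
    (lfNewTerms_graftAboveB _ _ _ hO2) (fun X z g hg0 hgγ => ?_) (fun X => ?_) (fun X a => ?_)
  · rw [graftAboveB_B_of_le tpar u le_rfl]; exact (hO1 h1).1 X φ a hφ
  · rw [graftAboveB_B_fun_of_le tpar u le_rfl]; exact (hO1 h1).2 X a
  · rw [graftAboveB_E_succ]; exact hanE X z g hg0 hgγ
  · rw [graftAboveB_R_succ]; exact hanR X
  · rw [graftAboveB_B_fun_of_le tpar u (Nat.le_succ k)]; exact hanB X a

end ChildLaws

/-! ## §3  The supply on the supplier's own terms: master guard, 𝐓-present children, labels -/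

end Summit.QuantumFields.YangMills.Theorems.BalabanUVNodesN11Sect3SupplySpliceOwnBoundaryChi

end

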